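import Literature.Claims.NS.Haitani2025
import Literature.Barriers.NavierStokesRegularity.ScalingAudit
import Summits.NavierStokesRegularity.NavierStokesRegularity.Theorems.SoloRefuteAtarka2026Lemma34
import HarnessLib

/-!
# KIT (salvage-made, NOT filed) — C133 `Haitani2025`, downstream erratum: display (27) p.7 is false in 3-D
# (`Step7a_Display27`), by the CONCENTRATION AUDIT of the barrier catalogue

Cell `ns-claims` (D-0090). For the refuter of record of C133 (refuter-3 g2) to adopt / rename / discard
(its REFUTER.md §6 lists «(27) `Step7a_Display27`: concentration family … needs explicit fields with a provably
non-zero trilinear integral» as open for successors); intended target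
`Summits/NavierStokesRegularity/NavierStokesRegularity/Theorems/SoloRefuteHaitani2025Display27.lean`
(`--kind refutation`, SOLO naming, filed by the salvage seat under conv. (b); ADDENDUM-grade — the C133 locator
`Step1_Display13` does not move). Author: ns-claims-salvage-p2 g3.

Display (27) p.7 («By Hölder's inequality: |∫_Ω (w·∇)u₂·w dx| ≤ C‖∇w‖_{L²}‖w‖_{L²}‖∇u₂‖_{L²}») is the
TWO-dimensional Ladyzhenskaya bound; in 3-D it is scale-inconsistent. Kernel route = the barrier catalogue's
one-sided scaling audit `Literature.Barriers.NavierStokesRegularity.ScalingAudit.not_exists_forall_le_of_concentration`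
(p492836) instantiated on the concentration orbit, centred at the cube's centre `c = (½,½,½)`, of ONE pair of
`C¹` fields supported in `B(c, 3/8) ⊂ Ω`: `w = θ e₀` (bump), `v = Θ·x₀ e₀` (`Θ ≡ 1` on `supp θ`), for which
`(w·∇)v = w` pointwise, so the trilinear form is `λ·‖w_λ‖²_{L²} = λ^{-2}A` along `w_λ = w(c + λ(· − c))`
(degree `s = −2`), while `‖∇w_λ‖‖w_λ‖‖∇v_λ‖ = λ^{-5/2}·const` (degree `r = −5/2 < s`).

Main theorem: `not_Step7a_Display27 : ¬ Literature.Claims.NS.Haitani2025.Step7a_Display27`.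

WHAT THIS IS NOT: not a claim about NS regularity or blow-up; not a claim about any author beyond the typed
locator.
-/

noncomputable section

open Set Function Filter MeasureTheory TopologicalSpace Metric
open scoped Topology ENNReal ContDiff InnerProductSpace RealInnerProductSpace

-- lint debt (cell convention, SoloRefute files): the Theorems namespace repeats `NavierStokesRegularity`.
set_option linter.dupNamespace false

namespace Summit.NavierStokesRegularity.NavierStokesRegularity.Theorems.Haitani2025

open Literature.Claims.NS.Haitani2025 Literature.Analysis.FluidPDE
open Literature.Claims.NS.Chio2026 (E3 gradSq)
open Literature.Claims.NS.Atarka2026 (e)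
open Summit.NavierStokesRegularity.NavierStokesRegularity.Theorems.Atarka2026
  (θ θ_rIn θ_rOut fderiv_comp_smul hasFDerivAt_comp_smul frobeniusNormSq_smul integral_comp_smul_E3 norm_e0)

/-! ### The two profiles -/

/-- A bigger bump `Θ`: `≡ 1` on `B(0,1/2) ⊇ supp θ`, supported in `B(0,3/4)`. -/
def Θ : ContDiffBump (0 : E3) := ⟨1 / 2, 3 / 4, by norm_num, by norm_num⟩

/-- The profile `w = θ e₀`. -/
def wB (x : E3) : E3 := (θ x) • e 0

/-- The profile `v = Θ·x₀ e₀` (equal to `x₀ e₀` on the support of `θ`). -/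
def vB (x : E3) : E3 := (Θ x * x 0) • e 0

/-- `w` is smooth. -/
theorem contDiff_wB : ContDiff ℝ ∞ wB := θ.contDiff.smul contDiff_const

/-- `v` is smooth. -/
theorem contDiff_vB : ContDiff ℝ ∞ vB :=
  (Θ.contDiff.mul (EuclideanSpace.proj (𝕜 := ℝ) (0 : Fin 3)).contDiff).smul contDiff_const

/-- `w` vanishes outside the open ball of radius `1/2`. -/
theorem wB_eq_zero_of_norm {x : E3} (hx : 1 / 2 ≤ ‖x‖) : wB x = 0 := by
  have : θ x = 0 := by
    rw [← Function.notMem_support, θ.support_eq, mem_ball, dist_zero_right, θ_rOut, not_lt]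
    exact hx
  simp [wB, this]

/-- `v` vanishes outside the open ball of radius `3/4`. -/
theorem vB_eq_zero_of_norm {x : E3} (hx : 3 / 4 ≤ ‖x‖) : vB x = 0 := by
  have : Θ x = 0 := by
    rw [← Function.notMem_support, Θ.support_eq, mem_ball, dist_zero_right, not_lt]
    exact hx
  simp [vB, this]

/-- `Dw = 0` outside the open ball of radius `1/2`. -/
theorem fderiv_wB_eq_zero {z : E3} (hz : 1 / 2 < ‖z‖) : fderiv ℝ wB z = 0 := by
  have h : wB =ᶠ[𝓝 z] fun _ => (0 : E3) := by
    have ho : IsOpen {y : E3 | 1 / 2 < ‖y‖} := isOpen_lt continuous_const continuous_norm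
    filter_upwards [ho.mem_nhds hz] with y hy using wB_eq_zero_of_norm (le_of_lt hy)
  rw [h.fderiv_eq, fderiv_const_apply]

/-- `Dv = 0` outside the open ball of radius `3/4`. -/
theorem fderiv_vB_eq_zero {z : E3} (hz : 3 / 4 < ‖z‖) : fderiv ℝ vB z = 0 := by
  have h : vB =ᶠ[𝓝 z] fun _ => (0 : E3) := by
    have ho : IsOpen {y : E3 | 3 / 4 < ‖y‖} := isOpen_lt continuous_const continuous_norm
    filter_upwards [ho.mem_nhds hz] with y hy using vB_eq_zero_of_norm (le_of_lt hy)
  rw [h.fderiv_eq, fderiv_const_apply]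

/-- The key pointwise identity: `(w·∇)v = w` (on `supp θ`, `v = x₀ e₀` and `∂₀(x₀ e₀) = e₀`). -/
theorem convect_wB_vB (y : E3) : convect wB vB y = wB y := by
  by_cases hθ : θ y = 0
  · simp [convect, wB, hθ]
  · have hy : ‖y‖ < 1 / 2 := by
      have : y ∈ Function.support θ := by rwa [Function.mem_support]
      rw [θ.support_eq, mem_ball, dist_zero_right, θ_rOut] at this
      exact this
    -- `v = x₀ e₀` near `y`
    have hv : vB =ᶠ[𝓝 y] fun z => ((EuclideanSpace.proj (𝕜 := ℝ) (0 : Fin 3)).smulRight (e 0)) z := by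
      have ho : IsOpen (ball (0 : E3) (1 / 2)) := isOpen_ball
      filter_upwards [ho.mem_nhds (by rwa [mem_ball, dist_zero_right])] with z hz
      have hΘ : Θ z = 1 := Θ.one_of_mem_closedBall (by
        rw [mem_closedBall, dist_zero_right]; rw [mem_ball, dist_zero_right] at hz
        exact le_of_lt (by simpa [Θ] using hz))
      simp [vB, hΘ]
    rw [convect, hv.fderiv_eq, ContinuousLinearMap.fderiv, wB]
    simp [e]

/-! ### The concentrates, centred at the cube's centre -/

/-- The centre `c = (½,½,½)` of the cube `Ω`. -/
def ctr : E3 := WithLp.toLp 2 fun _ : Fin 3 => (1 / 2 : ℝ)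

/-- Coordinates of the centre. -/
@[simp] theorem ctr_apply (i : Fin 3) : ctr i = 1 / 2 := rfl

/-- `w_λ(x) = w(λ(x − c))`. -/
def wS (lam : ℝ) (x : E3) : E3 := wB (lam • (x - ctr))

/-- `v_λ(x) = v(λ(x − c))`. -/
def vS (lam : ℝ) (x : E3) : E3 := vB (lam • (x - ctr))

/-- `w_λ` is smooth. -/
theorem contDiff_wS (lam : ℝ) : ContDiff ℝ ∞ (wS lam) :=
  contDiff_wB.comp ((contDiff_id.sub contDiff_const).const_smul lam)

/-- `v_λ` is smooth. -/
theorem contDiff_vS (lam : ℝ) : ContDiff ℝ ∞ (vS lam) :=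
  contDiff_vB.comp ((contDiff_id.sub contDiff_const).const_smul lam)

/-- A point of `B(c, 7/16)` lies in the open unit cube. -/
theorem mem_HOmega_of_norm_sub_lt {x : E3} (hx : ‖x - ctr‖ < 7 / 16) : x ∈ HOmega := by
  intro i
  have hi : |x i - 1 / 2| ≤ ‖x - ctr‖ := by
    have := PiLp.norm_apply_le (x - ctr) i   -- `‖(x - c) i‖ ≤ ‖x - c‖`
    simpa [Real.norm_eq_abs] using this
  have h := lt_of_le_of_lt hi hx
  rw [abs_lt] at h
  constructor <;> linarith [h.1, h.2]

/-- For `λ ≥ 2`, outside `B(c, 7/16)` the dilated argument has norm `> 3/4` (indeed `≥ 7/8`). -/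
theorem norm_smul_sub_gt {lam : ℝ} (hlam : 2 ≤ lam) {x : E3} (hx : x ∉ HOmega) :
    3 / 4 < ‖lam • (x - ctr)‖ := by
  have h : 7 / 16 ≤ ‖x - ctr‖ := not_lt.1 fun h => hx (mem_HOmega_of_norm_sub_lt h)
  rw [norm_smul, Real.norm_of_nonneg (by linarith)]
  nlinarith

/-- For `λ ≥ 2`, `w_λ` vanishes off `Ω`. -/
theorem wS_eq_zero {lam : ℝ} (hlam : 2 ≤ lam) {x : E3} (hx : x ∉ HOmega) : wS lam x = 0 :=
  wB_eq_zero_of_norm (le_trans (by norm_num) (norm_smul_sub_gt hlam hx).le)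

/-- For `λ ≥ 2`, `v_λ` vanishes off `Ω`. -/
theorem vS_eq_zero {lam : ℝ} (hlam : 2 ≤ lam) {x : E3} (hx : x ∉ HOmega) : vS lam x = 0 :=
  vB_eq_zero_of_norm (norm_smul_sub_gt hlam hx).le

/-- For `λ ≥ 2`, `w_λ` is supported in the closed cube. -/
theorem tsupport_wS {lam : ℝ} (hlam : 2 ≤ lam) : tsupport (wS lam) ⊆ closure HOmega := by
  refine closure_mono fun x hx => ?_
  by_contra h
  exact hx (wS_eq_zero hlam h)

/-- For `λ ≥ 2`, `v_λ` is supported in the closed cube. -/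
theorem tsupport_vS {lam : ℝ} (hlam : 2 ≤ lam) : tsupport (vS lam) ⊆ closure HOmega := by
  refine closure_mono fun x hx => ?_
  by_contra h
  exact hx (vS_eq_zero hlam h)

/-- Chain rule for the centred dilation: `D(f(λ(· − c)))(x) = λ·Df(λ(x − c))`. -/
theorem fderiv_comp_smul_sub {F : Type*} [NormedAddCommGroup F] [NormedSpace ℝ F] {f : E3 → F}
    (hf : Differentiable ℝ f) (lam : ℝ) (x : E3) :
    fderiv ℝ (fun y => f (lam • (y - ctr))) x = lam • fderiv ℝ f (lam • (x - ctr)) := by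
  have h1 : HasFDerivAt (fun y : E3 => lam • (y - ctr)) (lam • ContinuousLinearMap.id ℝ E3) x :=
    ((hasFDerivAt_id x).sub_const ctr).const_smul lam
  have h2 : HasFDerivAt (fun y => f (lam • (y - ctr)))
      ((fderiv ℝ f (lam • (x - ctr))).comp (lam • ContinuousLinearMap.id ℝ E3)) x :=
    (hf (lam • (x - ctr))).hasFDerivAt.comp x h1
  rw [h2.fderiv]
  ext v
  simp

/-- `(w_λ·∇)v_λ = λ·w_λ` pointwise. -/
theorem convect_wS_vS (lam : ℝ) (x : E3) : convect (wS lam) (vS lam) x = lam • wS lam x := by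
  have h : fderiv ℝ (vS lam) x = lam • fderiv ℝ vB (lam • (x - ctr)) :=
    fderiv_comp_smul_sub (contDiff_vB.differentiable (by simp)) lam x
  rw [convect, h]
  show lam • fderiv ℝ vB (lam • (x - ctr)) (wB (lam • (x - ctr))) = lam • wS lam x
  exact congrArg (fun z : E3 => lam • z) (convect_wB_vB (lam • (x - ctr)))

/-! ### The three norms along the orbit -/

/-- `A = ∫ ‖w‖²`. -/
def cAw : ℝ := ∫ z, ‖wB z‖ ^ 2
/-- `G_w = ∫ ‖Dw‖_F²`. -/
def cGw : ℝ := ∫ z, frobeniusNormSq (fderiv ℝ wB z)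
/-- `G_v = ∫ ‖Dv‖_F²`. -/
def cGv : ℝ := ∫ z, frobeniusNormSq (fderiv ℝ vB z)

/-- `G_w ≥ 0`. -/
theorem cGw_nonneg : 0 ≤ cGw := integral_nonneg fun _ => frobeniusNormSq_nonneg _
/-- `G_v ≥ 0`. -/
theorem cGv_nonneg : 0 ≤ cGv := integral_nonneg fun _ => frobeniusNormSq_nonneg _

/-- `A > 0`: `w(0) = e₀ ≠ 0` and `‖w‖²` is continuous with compact support. -/
theorem cAw_pos : 0 < cAw := by
  have hcont : Continuous fun z => ‖wB z‖ ^ 2 := (contDiff_wB.continuous.norm).pow 2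
  have hsupp : HasCompactSupport fun z => ‖wB z‖ ^ 2 := by
    refine HasCompactSupport.of_support_subset_isCompact (isCompact_closedBall (0 : E3) (1 / 2)) ?_
    intro z hz
    rw [mem_closedBall, dist_zero_right]
    by_contra h
    exact hz (by simp [wB_eq_zero_of_norm (le_of_lt (not_le.mp h))])
  unfold cAw
  rw [integral_pos_iff_support_of_nonneg (fun z => by positivity) (hcont.integrable_of_hasCompactSupport hsupp)]
  refine (hcont.isOpen_support).measure_pos volume ⟨0, ?_⟩
  have hθ : θ (0 : E3) = 1 := θ.one_of_mem_closedBall (by simp [θ_rIn])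
  rw [Function.mem_support, wB, hθ, one_smul, norm_e0]
  norm_num

/-- Change of variables for the centred dilation: `∫ f(λ(x − c)) dx = λ⁻³ ∫ f`. -/
theorem integral_comp_smul_sub (f : E3 → ℝ) {lam : ℝ} (hlam : 0 < lam) :
    ∫ x, f (lam • (x - ctr)) = (lam ^ 3)⁻¹ * ∫ x, f x := by
  rw [show (fun x : E3 => f (lam • (x - ctr))) = fun x => (fun y => f (lam • y)) (x - ctr) from rfl,
    integral_sub_right_eq_self (fun y : E3 => f (lam • y)) ctr]
  exact integral_comp_smul_E3 f hlam

/-- `‖w_λ‖²_{L²(Ω)} = λ⁻³ A` for `λ ≥ 2`. -/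
theorem l2Sq_wS {lam : ℝ} (hlam : 2 ≤ lam) : l2Sq (wS lam) = (lam ^ 3)⁻¹ * cAw := by
  unfold l2Sq cAw
  rw [setIntegral_eq_integral_of_forall_compl_eq_zero fun x hx => by simp [wS_eq_zero hlam hx]]
  exact integral_comp_smul_sub (fun z => ‖wB z‖ ^ 2) (by linarith)

/-- `‖∇w_λ‖²_{L²(Ω)} = λ²·λ⁻³ G_w` for `λ ≥ 2`. -/
theorem gradL2Sq_wS {lam : ℝ} (hlam : 2 ≤ lam) : gradL2Sq (wS lam) = lam ^ 2 * ((lam ^ 3)⁻¹ * cGw) := by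
  unfold gradL2Sq gradSq cGw
  have hfd : ∀ x, fderiv ℝ (wS lam) x = lam • fderiv ℝ wB (lam • (x - ctr)) := fun x =>
    fderiv_comp_smul_sub (contDiff_wB.differentiable (by simp)) lam x
  simp_rw [hfd, frobeniusNormSq_smul]
  rw [setIntegral_eq_integral_of_forall_compl_eq_zero fun x hx => by
    simp [fderiv_wB_eq_zero (lt_trans (by norm_num) (norm_smul_sub_gt hlam hx)), frobeniusNormSq],
    integral_const_mul, integral_comp_smul_sub (fun z => frobeniusNormSq (fderiv ℝ wB z)) (by linarith)]

/-- `‖∇v_λ‖²_{L²(Ω)} = λ²·λ⁻³ G_v` for `λ ≥ 2`. -/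
theorem gradL2Sq_vS {lam : ℝ} (hlam : 2 ≤ lam) : gradL2Sq (vS lam) = lam ^ 2 * ((lam ^ 3)⁻¹ * cGv) := by
  unfold gradL2Sq gradSq cGv
  have hfd : ∀ x, fderiv ℝ (vS lam) x = lam • fderiv ℝ vB (lam • (x - ctr)) := fun x =>
    fderiv_comp_smul_sub (contDiff_vB.differentiable (by simp)) lam x
  simp_rw [hfd, frobeniusNormSq_smul]
  rw [setIntegral_eq_integral_of_forall_compl_eq_zero fun x hx => by
    simp [fderiv_vB_eq_zero (norm_smul_sub_gt hlam hx), frobeniusNormSq],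
    integral_const_mul, integral_comp_smul_sub (fun z => frobeniusNormSq (fderiv ℝ vB z)) (by linarith)]

/-- The trilinear form along the orbit: `∫_Ω ⟪(w_λ·∇)v_λ, w_λ⟫ = λ·λ⁻³ A` for `λ ≥ 2`. -/
theorem trilinear_wS_vS {lam : ℝ} (hlam : 2 ≤ lam) :
    ∫ x in HOmega, ⟪convect (wS lam) (vS lam) x, wS lam x⟫_ℝ = lam * ((lam ^ 3)⁻¹ * cAw) := by
  simp_rw [convect_wS_vS, real_inner_smul_left, real_inner_self_eq_norm_sq]
  rw [integral_const_mul, ← l2Sq_wS hlam]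
  rfl

/-! ### Scaling arithmetic -/

/-- `λ·(λ⁻³·A) = λ^{-2}·A`. -/
theorem scale_trilinear {lam : ℝ} (hl : 0 < lam) (A : ℝ) :
    lam * ((lam ^ 3)⁻¹ * A) = lam ^ (-(2 : ℝ)) * A := by
  rw [Real.rpow_neg hl.le, Real.rpow_two]
  field_simp

/-- `√(λ²·λ⁻³·c) = λ^{-1/2}·√c`. -/
theorem sqrt_scale_grad {lam c : ℝ} (hl : 0 < lam) (hc : 0 ≤ c) :
    Real.sqrt (lam ^ 2 * ((lam ^ 3)⁻¹ * c)) = lam ^ (-(1 / 2 : ℝ)) * Real.sqrt c := by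
  have hpow : (lam ^ (-(1 / 2 : ℝ))) ^ 2 = lam⁻¹ := by
    rw [← Real.rpow_natCast (lam ^ (-(1 / 2 : ℝ))) 2, ← Real.rpow_mul hl.le,
      show (-(1 / 2 : ℝ)) * ((2 : ℕ) : ℝ) = -1 by norm_num, Real.rpow_neg_one]
  have h : lam ^ 2 * ((lam ^ 3)⁻¹ * c) = (lam ^ (-(1 / 2 : ℝ)) * Real.sqrt c) ^ 2 := by
    rw [mul_pow, hpow, Real.sq_sqrt hc]
    field_simp
  rw [h, Real.sqrt_sq (mul_nonneg (Real.rpow_nonneg hl.le _) (Real.sqrt_nonneg _))]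

/-- `√(λ⁻³·c) = λ^{-3/2}·√c`. -/
theorem sqrt_scale_mass {lam c : ℝ} (hl : 0 < lam) (hc : 0 ≤ c) :
    Real.sqrt ((lam ^ 3)⁻¹ * c) = lam ^ (-(3 / 2 : ℝ)) * Real.sqrt c := by
  have hpow : (lam ^ (-(3 / 2 : ℝ))) ^ 2 = (lam ^ 3)⁻¹ := by
    rw [← Real.rpow_natCast (lam ^ (-(3 / 2 : ℝ))) 2, ← Real.rpow_mul hl.le,
      show (-(3 / 2 : ℝ)) * ((2 : ℕ) : ℝ) = -((3 : ℕ) : ℝ) by norm_num, Real.rpow_neg hl.le, Real.rpow_natCast]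
  have h : (lam ^ 3)⁻¹ * c = (lam ^ (-(3 / 2 : ℝ)) * Real.sqrt c) ^ 2 := by
    rw [mul_pow, hpow, Real.sq_sqrt hc]
  rw [h, Real.sqrt_sq (mul_nonneg (Real.rpow_nonneg hl.le _) (Real.sqrt_nonneg _))]

/-- `λ^{-1/2}·λ^{-3/2}·λ^{-1/2} = λ^{-5/2}`. -/
theorem rpow_collect {lam : ℝ} (hl : 0 < lam) :
    lam ^ (-(1 / 2 : ℝ)) * lam ^ (-(3 / 2 : ℝ)) * lam ^ (-(1 / 2 : ℝ)) = lam ^ (-(5 / 2 : ℝ)) := by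
  rw [← Real.rpow_add hl, ← Real.rpow_add hl]
  norm_num

/-! ### The kill, via the barrier catalogue's concentration audit -/

/-- **Display (27) p.7 is false** («|∫_Ω (w·∇)u₂·w| ≤ C‖∇w‖‖w‖‖∇u₂‖» for one constant and all `C¹` fields
supported in the closed cube): along the concentration orbit `(w_λ, v_λ)`, `λ ≥ 2`, the left side is
`λ^{-2}A` (lower-homogeneous of degree `−2`) and the right side `C·λ^{-5/2}(G_w A G_v)^{1/2}`
(upper-homogeneous of degree `−5/2 < −2`), so `ScalingAudit.not_exists_forall_le_of_concentration` applies.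
[claim: Haitani2025NavierStokesGitHub, status: disputed]
WHAT THIS IS NOT: not a claim about NS regularity or blow-up; not a claim about any author beyond the typed
locator. -/
theorem not_Step7a_Display27 : ¬ Literature.Claims.NS.Haitani2025.Step7a_Display27 := by
  rintro ⟨C, hC⟩
  -- the orbit, the dilation action on pairs of fields, the two sides as functionals
  let X := (E3 → E3) × (E3 → E3)
  let δ : ℝ → X → X := fun l u => (fun x => u.1 (ctr + l • (x - ctr)), fun x => u.2 (ctr + l • (x - ctr)))
  let S : Set X := {u | ∃ lam : ℝ, 2 ≤ lam ∧ u = (wS lam, vS lam)}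
  let F : X → ℝ := fun u => |∫ x in HOmega, ⟪convect u.1 u.2 x, u.1 x⟫_ℝ|
  let G : X → ℝ := fun u =>
    Real.sqrt (Literature.Claims.NS.Haitani2025.gradL2Sq u.1) * Real.sqrt (l2Sq u.1) *
      Real.sqrt (Literature.Claims.NS.Haitani2025.gradL2Sq u.2)
  let K : ℝ := Real.sqrt cGw * Real.sqrt cAw * Real.sqrt cGv
  have hδ : ∀ (l lam : ℝ), δ l (wS lam, vS lam) = (wS (lam * l), vS (lam * l)) := by
    intro l lam
    ext x <;> simp [δ, wS, vS, smul_smul]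
  have hS : ∀ l : ℝ, 1 ≤ l → ∀ u ∈ S, δ l u ∈ S := by
    rintro l hl u ⟨lam, hlam, rfl⟩
    exact ⟨lam * l, by nlinarith, hδ l lam⟩
  -- exact values of the two sides along the orbit
  have hFval : ∀ lam : ℝ, 2 ≤ lam → F (wS lam, vS lam) = lam ^ (-(2 : ℝ)) * cAw := by
    intro lam hlam
    have hl : 0 < lam := by linarith
    show |∫ x in HOmega, ⟪convect (wS lam) (vS lam) x, wS lam x⟫_ℝ| = _
    rw [trilinear_wS_vS hlam, scale_trilinear hl,
      abs_of_nonneg (mul_nonneg (Real.rpow_nonneg hl.le _) cAw_pos.le)]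
  have hGval : ∀ lam : ℝ, 2 ≤ lam → G (wS lam, vS lam) = lam ^ (-(5 / 2 : ℝ)) * K := by
    intro lam hlam
    have hl : 0 < lam := by linarith
    show Real.sqrt (Literature.Claims.NS.Haitani2025.gradL2Sq (wS lam)) * Real.sqrt (l2Sq (wS lam)) *
        Real.sqrt (Literature.Claims.NS.Haitani2025.gradL2Sq (vS lam)) = _
    rw [gradL2Sq_wS hlam, l2Sq_wS hlam, gradL2Sq_vS hlam, sqrt_scale_grad hl cGw_nonneg,
      sqrt_scale_mass hl cAw_pos.le, sqrt_scale_grad hl cGv_nonneg, ← rpow_collect hl]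
    simp only [K]
    ring
  have hF : ∀ l : ℝ, 1 ≤ l → ∀ u ∈ S, l ^ (-(2 : ℝ)) * F u ≤ F (δ l u) := by
    rintro l hl u ⟨lam, hlam, rfl⟩
    rw [hδ, hFval lam hlam, hFval (lam * l) (by nlinarith),
      Real.mul_rpow (by linarith) (by linarith)]
    exact le_of_eq (by ring)
  have hG : ∀ l : ℝ, 1 ≤ l → ∀ u ∈ S, G (δ l u) ≤ l ^ (-(5 / 2 : ℝ)) * G u := by
    rintro l hl u ⟨lam, hlam, rfl⟩
    rw [hδ, hGval lam hlam, hGval (lam * l) (by nlinarith),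
      Real.mul_rpow (by linarith) (by linarith)]
    exact le_of_eq (by ring)
  have hG0 : ∀ u ∈ S, 0 ≤ G u := fun u _ => by positivity
  have hu₀ : ((wS 2, vS 2) : X) ∈ S := ⟨2, le_rfl, rfl⟩
  have hF₀ : 0 < F (wS 2, vS 2) := by
    rw [hFval 2 le_rfl]
    exact mul_pos (Real.rpow_pos_of_pos (by norm_num) _) cAw_pos
  have hle : ∀ u ∈ S, F u ≤ C * G u := by
    rintro u ⟨lam, hlam, rfl⟩
    have h := hC (wS lam) (vS lam) ((contDiff_wS lam).of_le (by simp)) ((contDiff_vS lam).of_le (by simp))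
      (tsupport_wS hlam) (tsupport_vS hlam)
    show |∫ x in HOmega, ⟪convect (wS lam) (vS lam) x, wS lam x⟫_ℝ| ≤
      C * (Real.sqrt (Literature.Claims.NS.Haitani2025.gradL2Sq (wS lam)) * Real.sqrt (l2Sq (wS lam)) *
        Real.sqrt (Literature.Claims.NS.Haitani2025.gradL2Sq (vS lam)))
    linarith [h]
  exact Literature.Barriers.NavierStokesRegularity.ScalingAudit.not_exists_forall_le_of_concentration
    hS hF hG hG0 (by norm_num : (-(5 / 2 : ℝ)) < -(2 : ℝ)) hu₀ hF₀ ⟨C, hle⟩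

end Summit.NavierStokesRegularity.NavierStokesRegularity.Theorems.Haitani2025
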